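import Literature.Analysis.FluidPDE.OseenSlabFields
import HarnessLib

/-!
# Sup-norm perturbation theory of the Oseen integral equation on a time slab, II:
  the Duhamel operators on slab fields

Analysis/FluidPDE file (definitions `slabBilin`, `slabLin`; everything else proved).  The
Oseen–Duhamel bilinear term `B_a(W₁, W₂)(t)(x)` of two bounded continuous slab fields is again a
bounded continuous slab field (joint continuity: `continuousOn_uncurry_oseenDuhamel`; sup bound
KNSS (4.4): `‖B_a(W₁,W₂)‖ ≤ C₀ ‖W₁‖ ‖W₂‖ 2√(b − a)`), bilinear (window calculus of the tree);
this gives the bounded bilinear operator `slabBilin` and the linearisation at a background `U`,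
`slabLin U = B_a(U, ·) + B_a(·, U)` (the tree's `linOseen`).

## References

* G. Koch, N. Nadirashvili, G. Seregin, V. Šverák, *Liouville theorems for the Navier–Stokes
  equations and applications*, Acta Math. 203 (2009) = arXiv:0709.3599, §4 (4.3)–(4.4)
  (`u = U + B(u,u)` solved on `L^∞` by a fixed point; `‖B(u,v)‖ ≤ C√T‖u‖‖v‖`).
  [KochNadirashviliSereginSverak2009]
* M. P. Coiculescu, S. Palasek, Invent. Math. 244 (2025) = arXiv:2503.14699, App. B, Prop. B.1
  (the linearised problem in the exponentially weighted sup norm). [CoiculescuPalasek2025]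
* D. Henry, *Geometric Theory of Semilinear Parabolic Equations*, LNM 840 (1981), §3.3–3.4
  (differentiable dependence on the data). [Henry1981]
-/

noncomputable section

open MeasureTheory Set Function Filter
open _root_.Topology
open scoped BoundedContinuousFunction

namespace Literature.Analysis.FluidPDE

variable {E : Type*} [NormedAddCommGroup E] [InnerProductSpace ℝ E] [FiniteDimensional ℝ E]
  [MeasurableSpace E] [BorelSpace E]

/-! ### The Duhamel operators on slab fields -/

section Duhamel

variable {a b : ℝ} (hab : a ≤ b)

omit [InnerProductSpace ℝ E] [FiniteDimensional ℝ E] [MeasurableSpace E] [BorelSpace E] in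
/-- Bounds of the physical field on the open slab, in the shape the window calculus wants.
[folklore] -/
theorem slabPhys_bound [NormedSpace ℝ E] (W : (Icc a b) × E →ᵇ E) (t : ℝ) :
    ∀ τ ∈ Ioo a t, ∀ y, ‖slabPhys hab W τ y‖ ≤ ‖W‖ := fun τ _ y =>
  norm_slabPhys_le hab W τ y

/-- **Joint continuity on the closed slab of the Duhamel term of two slab fields.** [folklore] -/
theorem continuousOn_uncurry_oseenDuhamel_slabPhys (W₁ W₂ : (Icc a b) × E →ᵇ E) :
    ContinuousOn (uncurry (oseenDuhamel 1 a (slabPhys hab W₁) (slabPhys hab W₂))) (Icc a b ×ˢ univ) :=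
  continuousOn_uncurry_oseenDuhamel one_pos (M := max ‖W₁‖ ‖W₂‖)
    (le_max_of_le_left (norm_nonneg _))
    (aestronglyMeasurable_uncurry_slabPhys hab W₁ _) (aestronglyMeasurable_uncurry_slabPhys hab W₂ _)
    (fun τ _ y => (norm_slabPhys_le hab W₁ τ y).trans (le_max_left _ _))
    (fun τ _ y => (norm_slabPhys_le hab W₂ τ y).trans (le_max_right _ _))

/-- Sup bound of the Duhamel term of two slab fields at slab times:
`‖B_a(W₁, W₂)(t)(x)‖ ≤ C₀ ‖W₁‖ ‖W₂‖ · 2√(b - a)`. [folklore] -/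
theorem norm_oseenDuhamel_slabPhys_le (W₁ W₂ : (Icc a b) × E →ᵇ E) {t : ℝ} (ht : t ∈ Icc a b)
    (x : E) :
    ‖oseenDuhamel 1 a (slabPhys hab W₁) (slabPhys hab W₂) t x‖ ≤
      oseenSliceConst E * (‖W₁‖ * ‖W₂‖) * (2 * Real.sqrt (b - a)) := by
  refine (norm_oseenDuhamel_le_const ht.1 (slabPhys_bound hab W₁ t) (slabPhys_bound hab W₂ t)
    x).trans ?_
  have hC := (oseenSliceConst_pos (E := E)).le
  gcongr
  exact ht.2

/-- **The bilinear Duhamel operator on slab fields** `(W₁, W₂) ↦ ((t, x) ↦ B_a(W₁, W₂)(t)(x))`,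
a bounded bilinear operator on `([a,b] × E →ᵇ E)` with norm `≤ C₀ · 2√(b - a)`
(KNSS 2009, (4.4)). [cite: KochNadirashviliSereginSverak2009, §4 (4.4)] -/
def slabBilin : ((Icc a b) × E →ᵇ E) →L[ℝ] ((Icc a b) × E →ᵇ E) →L[ℝ] ((Icc a b) × E →ᵇ E) :=
  LinearMap.mkContinuous₂
    { toFun := fun W₁ =>
        { toFun := fun W₂ => slabMk (oseenDuhamel 1 a (slabPhys hab W₁) (slabPhys hab W₂))
            (continuousOn_uncurry_oseenDuhamel_slabPhys hab W₁ W₂)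
            (oseenSliceConst E * (‖W₁‖ * ‖W₂‖) * (2 * Real.sqrt (b - a)))
            (fun t ht x => norm_oseenDuhamel_slabPhys_le hab W₁ W₂ ht x)
          map_add' := fun W₂ W₂' => by
            ext p
            simp only [slabMk_apply, BoundedContinuousFunction.coe_add, Pi.add_apply, slabPhys_add]
            exact oseenDuhamel_window_add_right (measurable_uncurry_slabPhys hab W₁)
              (measurable_uncurry_slabPhys hab W₂) (measurable_uncurry_slabPhys hab W₂')
              (slabPhys_bound hab W₁ _) (slabPhys_bound hab W₂ _) (slabPhys_bound hab W₂' _) _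
          map_smul' := fun r W₂ => by
            ext p
            simp only [slabMk_apply, BoundedContinuousFunction.coe_smul, RingHom.id_apply,
              slabPhys_smul]
            exact oseenDuhamel_smul_right 1 a r _ _ _ _ }
      map_add' := fun W₁ W₁' => by
        ext W₂ p
        simp only [LinearMap.coe_mk, AddHom.coe_mk, LinearMap.add_apply, slabMk_apply,
          BoundedContinuousFunction.coe_add, Pi.add_apply, slabPhys_add]
        exact oseenDuhamel_window_add_left (measurable_uncurry_slabPhys hab W₁)
          (measurable_uncurry_slabPhys hab W₁') (measurable_uncurry_slabPhys hab W₂)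
          (slabPhys_bound hab W₁ _) (slabPhys_bound hab W₁' _) (slabPhys_bound hab W₂ _) _
      map_smul' := fun r W₁ => by
        ext W₂ p
        simp only [LinearMap.coe_mk, AddHom.coe_mk, LinearMap.smul_apply, slabMk_apply,
          BoundedContinuousFunction.coe_smul, RingHom.id_apply, slabPhys_smul]
        exact oseenDuhamel_smul_left 1 a r _ _ _ _ }
    (oseenSliceConst E * (2 * Real.sqrt (b - a)))
    (fun W₁ W₂ => by
      simp only [LinearMap.coe_mk, AddHom.coe_mk]
      refine (norm_slabMk_le _ _ (by
        have := (oseenSliceConst_pos (E := E)).le; positivity) _).trans (le_of_eq ?_)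
      ring)

/-- Values of the bilinear Duhamel operator. [folklore] -/
@[simp]
theorem slabBilin_apply (W₁ W₂ : (Icc a b) × E →ᵇ E) (p : (Icc a b) × E) :
    slabBilin hab W₁ W₂ p = oseenDuhamel 1 a (slabPhys hab W₁) (slabPhys hab W₂) p.1 p.2 := rfl

/-- Physical field of the bilinear Duhamel operator on the slab. [folklore] -/
theorem slabPhys_slabBilin (W₁ W₂ : (Icc a b) × E →ᵇ E) {t : ℝ} (ht : t ∈ Icc a b) (x : E) :
    slabPhys hab (slabBilin hab W₁ W₂) t x =
      oseenDuhamel 1 a (slabPhys hab W₁) (slabPhys hab W₂) t x := by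
  rw [slabPhys_of_mem hab _ ht, slabBilin_apply]

/-- **The linearised Duhamel operator at a background slab field** `U`:
`W ↦ B_a(U, W) + B_a(W, U) = L_a[U](W)` (the tree's `linOseen`), a bounded operator on slab
fields (Coiculescu–Palasek 2025, App. B (B.1); KNSS 2009 §4). [cite: KochNadirashviliSereginSverak2009, §4 (4.4)] -/
def slabLin (U : (Icc a b) × E →ᵇ E) : ((Icc a b) × E →ᵇ E) →L[ℝ] ((Icc a b) × E →ᵇ E) :=
  slabBilin hab U + (slabBilin hab).flip U

/-- Values of the linearised operator: `slabLin U W = linOseen a (phys U) (phys W)`. [folklore] -/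
theorem slabLin_apply (U W : (Icc a b) × E →ᵇ E) (p : (Icc a b) × E) :
    slabLin hab U W p = linOseen a (slabPhys hab U) (slabPhys hab W) p.1 p.2 := by
  simp [slabLin, linOseen, ContinuousLinearMap.flip_apply]

/-- Physical field of the linearised operator on the slab. [folklore] -/
theorem slabPhys_slabLin (U W : (Icc a b) × E →ᵇ E) {t : ℝ} (ht : t ∈ Icc a b) (x : E) :
    slabPhys hab (slabLin hab U W) t x = linOseen a (slabPhys hab U) (slabPhys hab W) t x := by
  rw [slabPhys_of_mem hab _ ht, slabLin_apply]

end Duhamel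

end Literature.Analysis.FluidPDE

end
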